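import Summits.QuantumFields.YangMills.Theorems.AllWindowsColdBoxBoxHighLineBoxToChartReduction
import Summits.QuantumFields.YangMills.Theorems.AllWindowsColdBoxBoxHighLineLandauClosers

/-!
# T-S5.13A in the window of ✓T-S5.4J with ✓S4b discharged: the box → FP-chart small-field reduction with (i)/(ii) supplied by name
# (ASSEMBLY-S5 Steps A+B+C; LINE-19 S5 ⟨stmt-QuantumFields-24004⟩/⟨24335⟩)

Width seat `ym-line-sfw-p2-w2` (g31).  ✓`BoxToChart.boxPlaqCov_sub_chartCov_le` (p744057) takes the Landau representative (i) and the orbit-normaliser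
precision (ii) of ✓`fpRepresentation` as hypotheses.  Exactly as ✓`fpRepresentation_window` (fcl-p3), they are discharged here by S4b
`LandauBootstrapBound` at `(H, spl, r₀)`, `r₀ = √C_{4b}·H(1+log H)²·spl`, and ✓T-S5.4J `orbitNormaliserJacobianR` at `(H, β, r₀, r)` with
`δ = e^{−cH⁴}`:

* `boxPlaqCov_sub_chartCov_le_window (h4b : LandauBootstrapBound)` — in the window `C·H¹²(1+log β)⁸ ≤ β`, `e^{−cH⁴} ≤ 1/2`,
  `spl·H⁴(1+log H)² ≤ c₀`, `C r₀ H² ≤ 1`, `r₀ + 1/(H⁴(1+log β)²) ≤ r`, `C r H ≤ 1`, plus the small-field parameters `0 ≤ s ≤ 1/100`, `17s² ≤ spl²`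
  and the T-S5.6 conclusion `hτ`:  `|boxPlaqCov β H T − (⟨c₀c_T⟩_D − ⟨c₀⟩_D⟨c_T⟩_D)| ≤ 200·(e^{−cH⁴} + P_box(¬SP) + τ)`;
* `boxPlaqCov_sub_chartCov_le_window'` — the same with S4b discharged by the tree theorem ✓`stub_landauRepresentative`.

Everything proved, tree only; no definitions; standard axioms.
HONEST LABEL: plumbing for the T-S5.13 assembly of the XL stub S5 (`stub_landauSecondOrder`) of a critic-PASSed DRAFT line; `p` and `τ` remain inputs;
S5, U5, ⟨24004⟩ ⟨24335⟩ ⟨24336⟩ remain OPEN; no stub is closed by name, no crux, rung or summit is proved; **the Yang–Mills mass gap is NOT proved by this file.**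
-/

set_option autoImplicit false

noncomputable section

open MeasureTheory
open Literature.Probability.LatticeModels (Site)
open Literature.MathematicalPhysics.QuantumLattice (LGConfig gaugeTransformZd fundamentalRep)
open Summit.QuantumFields.YangMills.Theorems.WeakCouplingRates (boxState boxCentre boxPlaqCov)

namespace Summit.QuantumFields.YangMills.Theorems.AllWindowsColdBoxBoxHighLine

namespace BoxToChart

/-- ★★ **T-S5.13A in the T-S5.4J window, S4b as the only structural hypothesis.** -/
theorem boxPlaqCov_sub_chartCov_le_window (h4b : LandauBootstrapBound) :
    ∃ K C c c₀ : ℝ, 0 < K ∧ 0 < C ∧ 0 < c ∧ 0 < c₀ ∧ ∀ H : ℕ, 1 ≤ H → ∀ (β spl r s τ : ℝ) (T : ℕ), 2 ≤ β →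
      C * (H : ℝ) ^ 12 * (1 + Real.log β) ^ 8 ≤ β → Real.exp (-(c * (H : ℝ) ^ 4)) ≤ 1 / 2 →
      0 ≤ spl → spl * (H : ℝ) ^ 4 * (1 + Real.log H) ^ 2 ≤ c₀ →
      C * (K * H * (1 + Real.log H) ^ 2 * spl) * (H : ℝ) ^ 2 ≤ 1 →
      K * H * (1 + Real.log H) ^ 2 * spl + 1 / ((H : ℝ) ^ 4 * (1 + Real.log β) ^ 2) ≤ r → C * r * H ≤ 1 →
      0 ≤ s → s ≤ 1 / 100 → 17 * s ^ 2 ≤ spl ^ 2 → 0 ≤ τ →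
      (∫ a in chartDomain H \ smallField H s, fpChartWeight β H r a ≤ τ * ∫ a in smallField H (s / 2), fpChartWeight β H r a) →
      |boxPlaqCov (fundamentalRep (Fin 2)) β H T -
          ((∫ a in smallField H s, chartPlaqCost H (boxCentre H) 1 2 a * chartPlaqCost H (boxCentre H + Pi.single 0 (T : ℤ)) 1 2 a *
                fpChartWeight β H r a) / (∫ a in smallField H s, fpChartWeight β H r a) -
            (∫ a in smallField H s, chartPlaqCost H (boxCentre H) 1 2 a * fpChartWeight β H r a) /
                (∫ a in smallField H s, fpChartWeight β H r a) *
              ((∫ a in smallField H s, chartPlaqCost H (boxCentre H + Pi.single 0 (T : ℤ)) 1 2 a * fpChartWeight β H r a) /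
                (∫ a in smallField H s, fpChartWeight β H r a)))| ≤
        200 * (Real.exp (-(c * (H : ℝ) ^ 4)) + ((boxState (fundamentalRep (Fin 2)) β H) {U | ¬ SmallPlaquettes H spl U}).toReal + τ) := by
  obtain ⟨C₄, c₀, hC₄, hc₀, h4⟩ := h4b
  obtain ⟨C, c, hC, hc, hR⟩ := orbitNormaliserJacobianR
  refine ⟨Real.sqrt C₄, C, c, c₀, Real.sqrt_pos.2 hC₄, hC, hc, hc₀, ?_⟩
  intro H hH β spl r s τ T hβ hwin hδ hspl hprem hr₀C hgap hrC hs0 hs1 hspls hτ0 hτ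
  set r₀ : ℝ := Real.sqrt C₄ * H * (1 + Real.log H) ^ 2 * spl with hr₀
  have hHr : (1 : ℝ) ≤ (H : ℝ) := by exact_mod_cast hH
  have hlogH : 0 ≤ 1 + Real.log (H : ℝ) := by linarith [Real.log_nonneg hHr]
  have hr₀0 : 0 ≤ r₀ := by rw [hr₀]; positivity
  have hr₀sq : r₀ ^ 2 = C₄ * (H : ℝ) ^ 2 * (1 + Real.log H) ^ 4 * spl ^ 2 := by
    rw [hr₀]
    have := Real.sq_sqrt hC₄.le
    ring_nf
    rw [this]
    ring
  refine boxPlaqCov_sub_chartCov_le H hH (r₀ := r₀) T (by linarith) (Real.exp_pos _).le hδ ?_ ?_ hs0 hs1 hspls hτ0 hτ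
  · -- (i) the Landau representative from S4b
    intro U hU hsp
    obtain ⟨g, hg, hL, hlinks⟩ := h4 H hH spl hspl hprem U hU hsp
    exact ⟨g, hg, hL, fun e he => (hlinks e he).trans_eq hr₀sq.symm⟩
  · -- (ii) the orbit-normaliser precision from T-S5.4J
    intro V hV hlinks
    exact hR H hH β r₀ r hβ hwin hr₀0 hr₀C hgap hrC V hV hlinks

/-- ★★ **T-S5.13A in the T-S5.4J window, unconditional structural input** (S4b = ✓`stub_landauRepresentative`). -/
theorem boxPlaqCov_sub_chartCov_le_window' :
    ∃ K C c c₀ : ℝ, 0 < K ∧ 0 < C ∧ 0 < c ∧ 0 < c₀ ∧ ∀ H : ℕ, 1 ≤ H → ∀ (β spl r s τ : ℝ) (T : ℕ), 2 ≤ β →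
      C * (H : ℝ) ^ 12 * (1 + Real.log β) ^ 8 ≤ β → Real.exp (-(c * (H : ℝ) ^ 4)) ≤ 1 / 2 →
      0 ≤ spl → spl * (H : ℝ) ^ 4 * (1 + Real.log H) ^ 2 ≤ c₀ →
      C * (K * H * (1 + Real.log H) ^ 2 * spl) * (H : ℝ) ^ 2 ≤ 1 →
      K * H * (1 + Real.log H) ^ 2 * spl + 1 / ((H : ℝ) ^ 4 * (1 + Real.log β) ^ 2) ≤ r → C * r * H ≤ 1 →
      0 ≤ s → s ≤ 1 / 100 → 17 * s ^ 2 ≤ spl ^ 2 → 0 ≤ τ →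
      (∫ a in chartDomain H \ smallField H s, fpChartWeight β H r a ≤ τ * ∫ a in smallField H (s / 2), fpChartWeight β H r a) →
      |boxPlaqCov (fundamentalRep (Fin 2)) β H T -
          ((∫ a in smallField H s, chartPlaqCost H (boxCentre H) 1 2 a * chartPlaqCost H (boxCentre H + Pi.single 0 (T : ℤ)) 1 2 a *
                fpChartWeight β H r a) / (∫ a in smallField H s, fpChartWeight β H r a) -
            (∫ a in smallField H s, chartPlaqCost H (boxCentre H) 1 2 a * fpChartWeight β H r a) /
                (∫ a in smallField H s, fpChartWeight β H r a) *
              ((∫ a in smallField H s, chartPlaqCost H (boxCentre H + Pi.single 0 (T : ℤ)) 1 2 a * fpChartWeight β H r a) /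
                (∫ a in smallField H s, fpChartWeight β H r a)))| ≤
        200 * (Real.exp (-(c * (H : ℝ) ^ 4)) + ((boxState (fundamentalRep (Fin 2)) β H) {U | ¬ SmallPlaquettes H spl U}).toReal + τ) :=
  boxPlaqCov_sub_chartCov_le_window stub_landauRepresentative

end BoxToChart

end Summit.QuantumFields.YangMills.Theorems.AllWindowsColdBoxBoxHighLine

end
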